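import Literature.NumberTheory.Transcendental.KZSemiCanonicalReductionProofs

/-!
# `VolumeFormOffPlane` (stmt-KontsevichZagierPeriods-14935) — line `Sketch`,
stub `stub_unionSplit` (splitting a finite disjoint union into its pieces)

Generic finite disjoint-union splitter of the Kontsevich–Zagier calculus
(`Literature/NumberTheory/Transcendental/KZCalculus.lean`), used by the pair-form corollaries of
the line's sector theorems: if the domain of an integrand-`1` representation `r` of dimension `N`
is the disjoint union of the domains of integrand-`1` representations `R i` (`i : Fin k`), then
`[r] − ∑ᵢ [R i]` is a relation (iterated domain additivity, rule (1a):
`KZ.of_sub_sum_of_mem_relations` over `Finset.univ`, all four side conditions holding with EMPTY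
exceptional sets — each piece lies in the union, both integrands are `1`, the pieces cover, and
distinct pieces are disjoint), and the values add up (soundness `KZ.relations_le_ker_eval_holds`
applied to the relation, `KZ.eval` being additive with `KZ.eval_of`).

Shape-generic version of `toric_split_union`
(`SymplecticScissorsVolumeFormOffPlaneToricF.lean`, boxes), same proof.

Sources: Kontsevich–Zagier 2001, §1.2, rule (1).
-/

noncomputable section

open MeasureTheory Set
open Literature.NumberTheory.Transcendental

namespace Summit.KontsevichZagierPeriods.SymplecticScissors.LogPolytope

/-- **Splitting a finite disjoint union into its pieces** (iterated rule 1a plus soundness): if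
the domain of an integrand-`1` representation `r` is the disjoint union of the domains of the
integrand-`1` representations `R i` (`i : Fin k`), then `[r] − ∑ᵢ [R i]` is a KZ-relation and
`value r = ∑ᵢ value (R i)`. [Kontsevich–Zagier 2001, §1.2, rule (1); folklore] -/
theorem stub_unionSplit : (∀ (N k : ℕ) (r : KZ.IntegralRep N) (R : Fin k → KZ.IntegralRep N), r.domain = ⋃ i, (R i).domain → (∀ i j, i ≠ j → Disjoint (R i).domain (R j).domain) → (∀ p ∈ r.domain, r.integrand p = 1) → (∀ i, ∀ p ∈ (R i).domain, (R i).integrand p = 1) → KZ.of r - ∑ i, KZ.of (R i) ∈ KZ.relations ∧ r.value = ∑ i, (R i).value) := by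
  intro N k r R hrd hdisj hr hR
  have hsub : ∀ i, (R i).domain ⊆ r.domain := by
    intro i x hx
    rw [hrd]
    exact mem_iUnion.mpr ⟨i, hx⟩
  have hrel : KZ.of r - ∑ i, KZ.of (R i) ∈ KZ.relations := by
    refine KZ.of_sub_sum_of_mem_relations Finset.univ r R (fun i _ => ?_) (fun i _ => ?_) ?_ ?_
    · rw [sdiff_eq_empty.mpr (hsub i), measure_empty]
    · intro x hx
      rw [hR i x hx.1, hr x hx.2]
    · have : r.domain \ ⋃ i ∈ (Finset.univ : Finset (Fin k)), (R i).domain = ∅ := by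
        refine sdiff_eq_empty.mpr fun x hx => ?_
        rw [hrd] at hx
        obtain ⟨i, hi⟩ := mem_iUnion.mp hx
        exact mem_biUnion (Finset.mem_univ i) hi
      rw [this, measure_empty]
    · intro i _ i' _ hii'
      rw [(hdisj i i' hii').inter_eq, measure_empty]
  refine ⟨hrel, ?_⟩
  have h0 := KZ.relations_le_ker_eval_holds hrel
  rw [AddMonoidHom.mem_ker, map_sub, map_sum, KZ.eval_of, sub_eq_zero] at h0
  simpa only [KZ.eval_of] using h0

end Summit.KontsevichZagierPeriods.SymplecticScissors.LogPolytope

end
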